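import Summits.CriticalPhenomena.PercolationContinuityZ3.Theorems.Transplant.DkSKBits
import Summits.CriticalPhenomena.PercolationContinuityZ3.Theorems.Transplant.D4SKGeo
import HarnessLib

/-!
# Diamond films `D_k` certificate (generic thickness), III: THE INDEX ↔ VERTEX DICTIONARY — `vtx k z i`, its shadow and height, injectivity, adjacency, blocks, windows, columns

builds on p205010 (kernel theorem, internal audit signed; external expert review pending) — NOT used in this file.  Lane `prim-bschramm`, seat `prim-bschramm-p2` (gen 43; class C1b;
memo `HOME/bschramm/P2-LATTICES.md` §152); helper file (`--supports stmt-CriticalPhenomena-4575 --as helper`).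
«D4SKGeo» for the thickness-generic layout of «DkSKDefs»: the vertex of `D_k` at a bit index over the centre `z` (height `4·t + r`, the residue `r` read off the parities of the
column; an index whose height exceeds `k` is sent to the origin and never used); for `z ≡ (c₀, c₁) mod 2` and valid indices: the shadow is `z + (a − 5, b − 5)`, distinct indices give
distinct vertices, `adjB` is adjacency of `D_k`, every vertex over `sqBall z 5` has an index, and the block / window / centre / column tests read the corresponding sets of
«SqShadowVRouteData(X)» at radius `4`.  The relative columns `relU, relV` are those of «D4SKGeo».
[cite: ConwaySloane1999, Ch. 4 §7.3] [cite: DuminilCopinSidoraviciusTassion2016, §2.3 (proof of Fact 2)]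
-/

noncomputable section

namespace Summit.CriticalPhenomena.PercolationContinuityZ3.Theorems.Transplant

open Literature.Probability.Percolation Literature.Probability.LatticeModels SimpleGraph

namespace DiamondFilm.DK

open Slab111.SK (bitOf sdiff lowIdx maskBelow maskOfList endsOK orFold rd rdMask testBit_bitOf testBit_sdiff testBit_maskBelow of_testBit_maskBelow testBit_maskBelow_of
  testBit_orFold)
open DiamondFilm.SK (dT dA dB relU relV rel_eq digit_eq)

variable {C : DCtx} {z : Site 2}

/-! ## §1 The vertex at an index -/

/-- The residue class of the column of an index relative to the centre `z`, read off the parities of the column. [cite: ConwaySloane1999, Ch. 4 §7.3] -/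
def resZ (z : Site 2) (i : ℕ) : ℕ := if relU z i % 2 = 0 then (if relV z i % 2 = 0 then 0 else 3) else (if relV z i % 2 = 0 then 1 else 2)

/-- The height of the vertex at an index relative to the centre `z`: `4·t + r`. [cite: ConwaySloane1999, Ch. 4 §7.3] -/
def hgtZ (z : Site 2) (i : ℕ) : ℕ := 4 * dT i + resZ z i

/-- The residue relative to `z`, arithmetically. [folklore] -/
theorem resZ_cases (z : Site 2) (i : ℕ) :
    (relU z i % 2 = 0 ∧ relV z i % 2 = 0 ∧ resZ z i = 0) ∨ (relU z i % 2 = 1 ∧ relV z i % 2 = 0 ∧ resZ z i = 1) ∨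
      (relU z i % 2 = 1 ∧ relV z i % 2 = 1 ∧ resZ z i = 2) ∨ (relU z i % 2 = 0 ∧ relV z i % 2 = 1 ∧ resZ z i = 3) := by
  unfold resZ
  have h0 : relU z i % 2 = 0 ∨ relU z i % 2 = 1 := by omega
  have h1 : relV z i % 2 = 0 ∨ relV z i % 2 = 1 := by omega
  rcases h0 with h0 | h0 <;> rcases h1 with h1 | h1 <;> simp [h0, h1]

/-- The height relative to `z` fits the column. [cite: ConwaySloane1999, Ch. 4 §7.3] -/
theorem hgtZ_fits (z : Site 2) (i : ℕ) :
    (relU z i + relV z i) % 2 = ((hgtZ z i : ℕ) : ℤ) % 2 ∧ (relU z i - relV z i) % 2 = ((hgtZ z i : ℕ) : ℤ) % 2 ∧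
      ((relU z i + relV z i + (relU z i - relV z i) + (hgtZ z i : ℕ)) % 4 = 0 ∨ (relU z i + relV z i + (relU z i - relV z i) + (hgtZ z i : ℕ)) % 4 = 3) := by
  unfold hgtZ
  rcases resZ_cases z i with ⟨hu, hv, hr⟩ | ⟨hu, hv, hr⟩ | ⟨hu, hv, hr⟩ | ⟨hu, hv, hr⟩ <;> rw [hr] <;> push_cast <;> refine ⟨by omega, by omega, by omega⟩

/-- **The vertex of `D_k` at the index `i` over the centre `z`** (the origin if the height `4·t + r` exceeds `k`, a case never used). [cite: ConwaySloane1999, Ch. 4 §7.3] -/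
def vtx (k : ℕ) (z : Site 2) (i : ℕ) : diamondFilm k :=
  if h : hgtZ z i ≤ k then mkV (relU z i + relV z i) (relU z i - relV z i) (hgtZ z i) (hgtZ_fits z i) h else diamondFilmOrigin k

/-- The shadow of `vtx` (height within the film). [folklore] -/
theorem uv_vtx {k : ℕ} (z : Site 2) {i : ℕ} (h : hgtZ z i ≤ k) : uv (vtx k z i) = ![relU z i, relV z i] := by
  unfold vtx; rw [dif_pos h]; exact uv_mkV _ _ _ _ _

/-- Coordinates of `vtx` (height within the film). [folklore] -/
theorem crd_vtx {k : ℕ} (z : Site 2) {i : ℕ} (h : hgtZ z i ≤ k) :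
    crd (vtx k z i) 0 = relU z i + relV z i ∧ crd (vtx k z i) 1 = relU z i - relV z i ∧ crd (vtx k z i) 2 = hgtZ z i := by
  unfold vtx; rw [dif_pos h]; exact crd_mkV _ _ _ _ _

/-- The centre class matches the centre. [folklore] -/
def CtrOK (C : DCtx) (z : Site 2) : Prop := z 0 % 2 = C.c0 ∧ z 1 % 2 = C.c1

/-- **Under `CtrOK` the context's residue is the residue relative to `z`.** [folklore] -/
theorem res_eq_resZ (hz : CtrOK C z) (i : ℕ) : C.res i = resZ z i := by
  obtain ⟨h0, h1⟩ := hz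
  obtain ⟨ui, vi⟩ := rel_eq z i
  rcases res_cases C i with ⟨p, q, hr⟩ | ⟨p, q, hr⟩ | ⟨p, q, hr⟩ | ⟨p, q, hr⟩ <;>
    rcases resZ_cases z i with ⟨hu, hv, hr'⟩ | ⟨hu, hv, hr'⟩ | ⟨hu, hv, hr'⟩ | ⟨hu, hv, hr'⟩ <;> omega

/-- Under `CtrOK` the context's height is the height relative to `z`. [folklore] -/
theorem hgt_eq_hgtZ (hz : CtrOK C z) (i : ℕ) : C.hgt i = hgtZ z i := by
  rw [hgt_eq, hgtZ, res_eq_resZ hz]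

/-- **A valid index has its height within the film** (relative form). [folklore] -/
theorem hgtZ_le (hz : CtrOK C z) {i : ℕ} (hv : C.validB i = true) : hgtZ z i ≤ C.k := by
  rw [← hgt_eq_hgtZ hz]; exact ((validB_iff C i).1 hv).2.2.2

/-- First shadow coordinate of a valid index. [folklore] -/
theorem sh_vtx_zero (hz : CtrOK C z) {i : ℕ} (hv : C.validB i = true) : uv (vtx C.k z i) 0 = z 0 + ((dA i : ℤ) - 5) := by
  rw [uv_vtx z (hgtZ_le hz hv)]; rfl
/-- Second shadow coordinate of a valid index. [folklore] -/
theorem sh_vtx_one (hz : CtrOK C z) {i : ℕ} (hv : C.validB i = true) : uv (vtx C.k z i) 1 = z 1 + ((dB i : ℤ) - 5) := by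
  rw [uv_vtx z (hgtZ_le hz hv)]; rfl
/-- The height of a valid index. [folklore] -/
theorem crd_vtx_two (hz : CtrOK C z) {i : ℕ} (hv : C.validB i = true) : crd (vtx C.k z i) 2 = C.hgt i := by
  rw [(crd_vtx z (hgtZ_le hz hv)).2.2, hgt_eq_hgtZ hz]

/-- **Distinct valid indices give distinct vertices.** [folklore] -/
theorem vtx_inj (hz : CtrOK C z) {i j : ℕ} (hi : C.validB i = true) (hj : C.validB j = true) (h : vtx C.k z i = vtx C.k z j) : i = j := by
  have hu := congrArg (fun x => uv x 0) h
  have hv := congrArg (fun x => uv x 1) h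
  have hh := congrArg (fun x => crd x 2) h
  simp only [sh_vtx_zero hz hi, sh_vtx_zero hz hj, sh_vtx_one hz hi, sh_vtx_one hz hj, crd_vtx_two hz hi, crd_vtx_two hz hj] at hu hv hh
  have hdi := digits C i hi
  have hdj := digits C j hj
  obtain ⟨ai, bi, ti⟩ := digit_eq i
  obtain ⟨aj, bj, tj⟩ := digit_eq j
  have gi := hgt_eq C i
  have gj := hgt_eq C j
  have ha : dA i = dA j := by omega
  have hb : dB i = dB j := by omega
  have hr : C.res i = C.res j := res_of_digits C ha hb
  have hh' : C.hgt i = C.hgt j := by exact_mod_cast hh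
  have ht : dT i = dT j := by omega
  omega

/-! ## §2 Adjacency -/

/-- **Adjacent valid indices are adjacent vertices of `D_k`.** [cite: ConwaySloane1999, Ch. 4 §7.3] -/
theorem adj_vtx (hz : CtrOK C z) {i j : ℕ} (hi : C.validB i = true) (hj : C.validB j = true) (h : C.adjB i j = true) :
    (diamondGraph.induce (diamondFilm C.k)).Adj (vtx C.k z i) (vtx C.k z j) := by
  rw [adj_crd_iff]
  obtain ⟨a0, a1, a2⟩ := crd_vtx z (hgtZ_le hz hi)
  obtain ⟨b0, b1, b2⟩ := crd_vtx z (hgtZ_le hz hj)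
  rw [a0, a1, a2, b0, b1, b2, ← hgt_eq_hgtZ hz, ← hgt_eq_hgtZ hz]
  obtain ⟨ui, vi⟩ := rel_eq z i
  obtain ⟨uj, vj⟩ := rel_eq z j
  rw [adjB_iff] at h
  obtain ⟨-, -, hh, h⟩ := h
  rcases h with ⟨-, hb, ha⟩ | ⟨-, ha, hb⟩
  · refine ⟨by omega, by omega, by omega⟩
  · refine ⟨by omega, by omega, by omega⟩

/-- **Adjacent vertices of valid indices have adjacent indices.** [cite: ConwaySloane1999, Ch. 4 §7.3] -/
theorem adjB_of_adj (hz : CtrOK C z) {i j : ℕ} (hi : C.validB i = true) (hj : C.validB j = true)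
    (h : (diamondGraph.induce (diamondFilm C.k)).Adj (vtx C.k z i) (vtx C.k z j)) : C.adjB i j = true := by
  have hs := uv_step h
  rw [adj_crd_iff] at h
  obtain ⟨-, -, h2⟩ := h
  rw [(crd_vtx z (hgtZ_le hz hi)).2.2, (crd_vtx z (hgtZ_le hz hj)).2.2, ← hgt_eq_hgtZ hz, ← hgt_eq_hgtZ hz] at h2
  rw [sh_vtx_zero hz hi, sh_vtx_zero hz hj, sh_vtx_one hz hi, sh_vtx_one hz hj] at hs
  obtain ⟨h0, h1⟩ := hz
  obtain ⟨ai, bi, ti⟩ := digit_eq i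
  obtain ⟨aj, bj, tj⟩ := digit_eq j
  have hdi := digits C i hi
  have hdj := digits C j hj
  have gi := res_cases C i
  have gj := res_cases C j
  have hgi := hgt_eq C i
  have hgj := hgt_eq C j
  rw [adjB_iff]
  refine ⟨hi, hj, by omega, ?_⟩
  rcases hs with ⟨hv, hu⟩ | ⟨hu, hv⟩
  · -- horizontal step: `b` equal, `a` adjacent, hence the lower height is even
    left
    have hb : dB i = dB j := by omega
    have ha : dA i = dA j + 1 ∨ dA j = dA i + 1 := by omega
    refine ⟨?_, hb, ha⟩
    rcases gi with ⟨p1, q1, r1⟩ | ⟨p1, q1, r1⟩ | ⟨p1, q1, r1⟩ | ⟨p1, q1, r1⟩ <;>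
      rcases gj with ⟨p2, q2, r2⟩ | ⟨p2, q2, r2⟩ | ⟨p2, q2, r2⟩ | ⟨p2, q2, r2⟩ <;> omega
  · -- vertical step
    right
    have ha : dA i = dA j := by omega
    have hb : dB i = dB j + 1 ∨ dB j = dB i + 1 := by omega
    refine ⟨?_, ha, hb⟩
    rcases gi with ⟨p1, q1, r1⟩ | ⟨p1, q1, r1⟩ | ⟨p1, q1, r1⟩ | ⟨p1, q1, r1⟩ <;>
      rcases gj with ⟨p2, q2, r2⟩ | ⟨p2, q2, r2⟩ | ⟨p2, q2, r2⟩ | ⟨p2, q2, r2⟩ <;> omega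

/-- **Every vertex of `D_k` over `sqBall z 5` has a valid index.** [folklore] -/
theorem exists_idx (hz : CtrOK C z) (x : diamondFilm C.k) (hx : uv x ∈ sqBall z 5) : ∃ i, C.validB i = true ∧ vtx C.k z i = x := by
  rw [mem_sqBall_iff_linear] at hx
  obtain ⟨p0, p1, p2, h3, h4⟩ := crd_facts x
  obtain ⟨e0, e1⟩ := crd_eq_of_uv x
  obtain ⟨A, hA⟩ := Int.eq_ofNat_of_zero_le (show (0 : ℤ) ≤ uv x 0 - z 0 + 5 by push_cast at hx; omega)
  obtain ⟨B, hB⟩ := Int.eq_ofNat_of_zero_le (show (0 : ℤ) ≤ uv x 1 - z 1 + 5 by push_cast at hx; omega)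
  obtain ⟨H, hH⟩ := Int.eq_ofNat_of_zero_le h3
  set t : ℕ := H / 4 with htdef
  set i : ℕ := 144 * t + 12 * A + B with hidef
  have hA10 : A ≤ 10 := by push_cast at hx; omega
  have hB10 : B ≤ 10 := by push_cast at hx; omega
  have hdA : dA i = A := by unfold dA; omega
  have hdB : dB i = B := by unfold dB; omega
  have hdT : dT i = t := by unfold dT; omega
  have hU : relU z i = uv x 0 := by unfold relU; rw [hdA]; omega
  have hV : relV z i = uv x 1 := by unfold relV; rw [hdB]; omega
  have hHk : H ≤ C.k := by exact_mod_cast (hH ▸ h4)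
  -- the residue of the column of `i` is `H mod 4`, from the diamond arithmetic of `x`
  rw [e0, e1] at p2; rw [e0] at p0
  rw [hH] at p2 p0
  have hres : C.res i = H % 4 := by
    rw [res_eq_resZ hz]
    have hc := resZ_cases z i
    rw [hU, hV] at hc
    rcases hc with ⟨hu, hv, hr⟩ | ⟨hu, hv, hr⟩ | ⟨hu, hv, hr⟩ | ⟨hu, hv, hr⟩ <;> rw [hr] <;> omega
  have hhgt : C.hgt i = H := by rw [hgt_eq, hdT, hres, htdef]; omega
  have hv : C.validB i = true := by
    rw [validB_iff]
    refine ⟨?_, by rw [hdA]; exact hA10, by rw [hdB]; exact hB10, by rw [hhgt]; exact hHk⟩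
    show i < 144 * (C.k / 4 + 1)
    have : t ≤ C.k / 4 := by rw [htdef]; exact Nat.div_le_div_right hHk
    omega
  refine ⟨i, hv, ?_⟩
  apply ext_crd; intro s
  obtain ⟨c0, c1, c2⟩ := crd_vtx z (hgtZ_le hz hv)
  fin_cases s
  · show crd (vtx C.k z i) 0 = crd x 0; rw [c0, hU, hV, e0]
  · show crd (vtx C.k z i) 1 = crd x 1; rw [c1, hU, hV, e1]
  · show crd (vtx C.k z i) 2 = crd x 2
    rw [c2, ← hgt_eq_hgtZ hz, hhgt, hH]

/-- **A neighbour of the vertex of an index over `sqBall z 4` has a valid index, adjacent in `adjB`.** [folklore] -/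
theorem exists_idx_of_adj (hz : CtrOK C z) {i : ℕ} (hi : C.validB i = true) (h4 : uv (vtx C.k z i) ∈ sqBall z 4)
    {y : diamondFilm C.k} (h : (diamondGraph.induce (diamondFilm C.k)).Adj (vtx C.k z i) y) :
    ∃ j, C.validB j = true ∧ vtx C.k z j = y ∧ C.adjB i j = true := by
  have hy : uv y ∈ sqBall z 5 := by
    have hs := uv_step h
    rw [mem_sqBall_iff_linear] at h4 ⊢
    rcases hs with ⟨h0, h1⟩ | ⟨h0, h1⟩ <;> push_cast at h4 ⊢ <;> omega
  obtain ⟨j, hj, rfl⟩ := exists_idx hz y hy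
  exact ⟨j, hj, rfl, adjB_of_adj hz hi hj h⟩

/-! ## §3 Reading the block, window, centre and column tests -/

/-- The shadow of a valid index lies in `sqBall z n` iff its digits do. [folklore] -/
theorem sqBall_vtx_iff (hz : CtrOK C z) {i : ℕ} (hv : C.validB i = true) (n : ℕ) :
    uv (vtx C.k z i) ∈ sqBall z n ↔ dA i ≤ n + 5 ∧ 5 ≤ dA i + n ∧ dB i ≤ n + 5 ∧ 5 ≤ dB i + n := by
  rw [mem_sqBall_iff_linear, sh_vtx_zero hz hv, sh_vtx_one hz hv]; omega

/-- **The rerouting-block test reads membership in `sqBlkR 4 z tR sR`.** [folklore] -/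
theorem inRB_iff_mem_blkR (hz : CtrOK C z) {i : ℕ} (hv : C.validB i = true) {tR sR : ℕ} (htR : C.tR = min tR 4) (hsR : min C.sR 4 = min sR 4) :
    C.inRB i = true ↔ uv (vtx C.k z i) ∈ sqBlkR 4 z tR sR := by
  rw [mem_sqBlkR, sqBall_vtx_iff hz hv, sh_vtx_zero hz hv, sh_vtx_one hz hv]
  simp only [DCtx.inRB, DCtx.inBlkB, hv, Bool.true_and, Bool.and_eq_true, decide_eq_true_eq, htR, hsR]
  omega

/-- Membership in the cleared block `sqBlkR 4 z tD sD` from the cleared-block test. [folklore] -/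
theorem mem_blkR_of_inDB (hz : CtrOK C z) {i : ℕ} {tD sD : ℕ} (htD : min C.tD 4 = min tD 4) (hsD : min C.sD 4 = min sD 4) (h : C.inDB i = true) :
    uv (vtx C.k z i) ∈ sqBlkR 4 z tD sD := by
  have hv : C.validB i = true := by simp only [DCtx.inDB, DCtx.inBlkB, Bool.and_eq_true] at h; exact h.1.1.1.1.1.1
  rw [mem_sqBlkR, sqBall_vtx_iff hz hv, sh_vtx_zero hz hv, sh_vtx_one hz hv]
  simp only [DCtx.inDB, DCtx.inBlkB, Bool.and_eq_true, decide_eq_true_eq] at h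
  omega

/-- The cleared-block test from membership in `sqBall z 1 ∩ sqBlkR 4 z tD sD` (the forced core). [folklore] -/
theorem core_of_mem (hz : CtrOK C z) {i : ℕ} (hv : C.validB i = true) {tD sD : ℕ} (htD : min C.tD 4 = min tD 4) (hsD : min C.sD 4 = min sD 4)
    (h1 : uv (vtx C.k z i) ∈ sqBall z 1) (hD : uv (vtx C.k z i) ∈ sqBlkR 4 z tD sD) :
    C.inDB i = true ∧ 4 ≤ dA i ∧ dA i ≤ 6 ∧ 4 ≤ dB i ∧ dB i ≤ 6 := by
  rw [sqBall_vtx_iff hz hv] at h1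
  rw [mem_sqBlkR, sqBall_vtx_iff hz hv, sh_vtx_zero hz hv, sh_vtx_one hz hv] at hD
  simp only [DCtx.inDB, DCtx.inBlkB, hv, Bool.true_and, Bool.and_eq_true, decide_eq_true_eq]
  omega

/-- **The `γ`-window test from the real window** (the case window at least the real one). [folklore] -/
theorem inWinB_of_inWin (hz : CtrOK C z) {i : ℕ} (hv : C.validB i = true) {tD sR : ℕ} (hwT : tD ≤ C.tD ∨ 5 ≤ C.tD) (hwS : sR ≤ C.sR ∨ 5 ≤ C.sR)
    (h : SqShadow.InWin z tD sR (uv (vtx C.k z i))) : C.inWinB i = true := by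
  unfold SqShadow.InWin at h
  rw [sh_vtx_zero hz hv, sh_vtx_one hz hv] at h
  have hv' := (validB_iff C i).1 hv
  simp only [DCtx.inWinB, hv, Bool.true_and, Bool.and_eq_true, decide_eq_true_eq]
  omega

/-- **The exit-window test from the real exit window.** [folklore] -/
theorem inWinDB_of_inWin (hz : CtrOK C z) {i : ℕ} (hv : C.validB i = true) {tD sD : ℕ} (hwT : tD ≤ C.tD ∨ 5 ≤ C.tD) (hwS : sD ≤ C.sD ∨ 5 ≤ C.sD)
    (h : SqShadow.InWin z tD sD (uv (vtx C.k z i))) : C.inWinDB i = true := by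
  unfold SqShadow.InWin at h
  rw [sh_vtx_zero hz hv, sh_vtx_one hz hv] at h
  have hv' := (validB_iff C i).1 hv
  simp only [DCtx.inWinDB, hv, Bool.true_and, Bool.and_eq_true, decide_eq_true_eq]
  omega

/-- **The centre test reads "over `z`".** [folklore] -/
theorem cenB_iff (hz : CtrOK C z) {i : ℕ} (hv : C.validB i = true) : C.cenB i = true ↔ uv (vtx C.k z i) = z := by
  simp only [DCtx.cenB, hv, Bool.true_and, Bool.and_eq_true, beq_iff_eq]
  rw [uv_vtx z (hgtZ_le hz hv)]
  obtain ⟨ui, vi⟩ := rel_eq z i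
  constructor
  · rintro ⟨ha, hb⟩; ext t; fin_cases t
    · show relU z i = z 0; rw [ui, ha]; simp
    · show relV z i = z 1; rw [vi, hb]; simp
  · intro h
    have h0 : relU z i = z 0 := congrFun h 0
    have h1 : relV z i = z 1 := congrFun h 1
    omega

/-- Two valid indices lie over the same column iff their column codes agree. [folklore] -/
theorem sh_eq_iff_mod (hz : CtrOK C z) {i j : ℕ} (hi : C.validB i = true) (hj : C.validB j = true) :
    uv (vtx C.k z i) = uv (vtx C.k z j) ↔ i % 144 = j % 144 := by
  rw [uv_vtx z (hgtZ_le hz hi), uv_vtx z (hgtZ_le hz hj)]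
  obtain ⟨ui, vi⟩ := rel_eq z i
  obtain ⟨uj, vj⟩ := rel_eq z j
  obtain ⟨ai, bi, -⟩ := digit_eq i
  obtain ⟨aj, bj, -⟩ := digit_eq j
  have hdi := digits C i hi
  have hdj := digits C j hj
  constructor
  · intro h
    have h0 : relU z i = relU z j := congrFun h 0
    have h1 : relV z i = relV z j := congrFun h 1
    omega
  · intro h; ext t; fin_cases t
    · show relU z i = relU z j; omega
    · show relV z i = relV z j; omega

/-- **Bits of a column mask**: the valid indices with the same column code. [folklore] -/
theorem testBit_colM_iff (C : DCtx) (e i : ℕ) : (C.colM e).testBit i = true ↔ C.validB i = true ∧ i % 144 = e % 144 := by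
  unfold DCtx.colM
  rw [Nat.testBit_land, Bool.and_eq_true, testBit_univ_iff, testBit_orFold]
  constructor
  · rintro ⟨⟨t, -, ht⟩, hv⟩
    rw [testBit_bitOf, decide_eq_true_eq] at ht
    exact ⟨hv, by omega⟩
  · rintro ⟨hv, hmod⟩
    have hi := ((validB_iff C i).1 hv).1
    refine ⟨⟨i / 144, ?_, ?_⟩, hv⟩
    · rw [List.mem_range]
      unfold DCtx.N at hi
      exact Nat.div_lt_of_lt_mul hi
    · rw [testBit_bitOf, decide_eq_true_eq]; omega

/-- Column mask membership reads equality of shadows. [folklore] -/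
theorem testBit_colM_iff_sh (hz : CtrOK C z) {e i : ℕ} (he : C.validB e = true) (hi : C.validB i = true) :
    (C.colM e).testBit i = true ↔ uv (vtx C.k z i) = uv (vtx C.k z e) := by
  rw [testBit_colM_iff, sh_eq_iff_mod hz hi he]
  exact ⟨fun h => h.2, fun h => ⟨hi, h⟩⟩

end DiamondFilm.DK

end Summit.CriticalPhenomena.PercolationContinuityZ3.Theorems.Transplant

end
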